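import Mathlib
import Literature.NumberTheory.EllipticCurves.BipartiteToricPeriod
import HarnessLib

/-!
# Route `AdditiveKolyvaginRoad`, crux `KolyvaginPrimitiveAdditive` (item stmt-BirchSwinnertonDyer-20132):
# the PINNED DATA of the birth skeleton v2 as an importable module (definitions)
# (cell `pub/bsd-wall`, lead prover `bsd-wall-akr-p1`; `--supports stmt-BirchSwinnertonDyer-20132`; kind definition)

WHY THIS FILE. The registered skeleton v2 of crux 20132 (planner bsd-wall-add g2, `Cruxes/KolyvaginPrimitiveAdditive/
Lines/birth.lean`, sha 9a54d1da…, stubs `stub_levelRaisingSupplyAdditiveLevel` (S), `stub_rankZeroAnchorToricUnit` (A),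
`stub_firstReciprocityAdditiveLevel` (B), `stub_higherSelmerRank` (C)) states S, A and B in terms of a structure
`DefiniteLevelRaisedDatum` and a function `DefiniteLevelRaisedDatum.toricPeriod` that it DECLARES LOCALLY. A skeleton
is not a tree module, so no `Theorems/` file can prove one of these stubs BY NAME + SIGNATURE unless the structure lives
in an importable module with the same meaning (the lesson of crux 19574 `ZhangSharpFrameAtThreeHL`, skeleton `method2`
v2 → v2t, whose pinned data became `Theorems/KolyvaginRoadThreeMethod2Defs.lean`). This file is that module for
crux 20132: the structure and the toric period VERBATIM (field names, binders and bodies unchanged; field docstrings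
added), nothing else. The skeleton then imports this file, opens this namespace and drops its local copies; stub
provers import it too.

HONEST FRAMING. Definitions only: a structure that PACKAGES, binder for binder, the definite-side data of the tree fact
`Literature.NumberTheory.EllipticCurves.kim_selmerCorank_baseChange_le_of_toricPeriod_ne_zero` at `M = 1`, `N⁺ = N`,
`N⁻ = 1`, `n = q` (the definite quaternion algebra ramified exactly at one admissible prime `q`, an Eichler order of
level `N = N_E` — here `p² ∣ N` —, its invertible right ideals, the anemic Hecke eigen-predicate, a mod-`p` eigenfunction
that is primitive and alone on its eigenline, a conductor-`1` Gross point), and its toric period. Nothing about Heegner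
points, level raising, multiplicity one or the crux is asserted; no named fact; no instance; no notation; no `sorry`.
Whether such a datum EXISTS at a ♯ additive frame is exactly stub S of the skeleton (its last-but-one field `multOne` —
mod-`p` multiplicity one for the definite algebra at Eichler level `Γ₀(N)` with `p² ∣ N` — is the input not in print).

## The objects (W. Zhang, Camb. J. Math. 2 (2014), §2 (definite case), §4.1; C.-H. Kim, TAMS 377 (2024), §4.2.3;
B. H. Gross, CMS Conf. Proc. 7 (1987), §3)

* `DefiniteLevelRaisedDatum W p K q` — the datum at one admissible prime `q` (mod `p`, `E`-currency).
* `DefiniteLevelRaisedDatum.toricPeriod` — `λ(q) = Σ_{[𝔞] ∈ Pic 𝓞_K} φ(ψ(𝔞)·I) ∈ ℤ/p`.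

References: [cite: WZhang2014, §2 (definite case) and §4.1] [cite: Kim2024, §4.2.3 (toric periods)]
[cite: Gross1987, §3 (special points and periods)].
-/

-- single-conjunct summit: `Summit.BirchSwinnertonDyer.BirchSwinnertonDyer.…` repeats the name by design
set_option linter.dupNamespace false

noncomputable section

open scoped Classical BigOperators

namespace Summit.BirchSwinnertonDyer.BirchSwinnertonDyer.Theorems.AdditiveKoly

open WeierstrassCurve Literature.NumberTheory.EllipticCurves

/-- The DEFINITE-SIDE DATUM at one admissible prime `q` (mod `p`, `E`-currency), binder for binder
the data of `kim_selmerCorank_baseChange_le_of_toricPeriod_ne_zero` at `M = 1`, `N⁺ = N`,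
`N⁻ = 1`, `n = q`: the definite quaternion algebra `B = (a, b)_ℚ` ramified exactly at `q` (and `∞`),
an Eichler order `O` of level `N = N_E` (here `p² ∣ N`), its invertible right ideals `RI`
(`= B̂×/R̂×`), the eigen-predicate (`B×`-invariance + `T_ℓ g = a_ℓ(E) g` for `ℓ ∤ N q`), a mod-`p`
eigenfunction `φ` that is PRIMITIVE and ALONE ON ITS EIGENLINE (multiplicity one mod `p` — a
hypothesis, exactly as in the Kim fact), and a conductor-`1` Gross point `(ψ, I)` with ideal-class
representatives `rep`.  Zhang 2014 §2 (definite case), §4.1; Kim 2024 §4.2.3. Nothing asserted.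
(Verbatim the structure of the birth skeleton v2 of crux 20132, planner bsd-wall-add g2.)
[cite: WZhang2014, §2 (definite case) and §4.1] [cite: Kim2024, §4.2.3] -/
structure DefiniteLevelRaisedDatum (W : WeierstrassCurve ℚ) [W.IsElliptic] [W.IsGloballyMinimal]
    (p : ℕ) (K : Type) [Field K] [NumberField K] (q : ℕ) where
  /-- First structure constant of the quaternion algebra `B = (a, b)_ℚ`. -/
  a : ℚ
  /-- Second structure constant of `B = (a, b)_ℚ`. -/
  b : ℚ
  /-- The Eichler order `O ⊂ B` of level `N`. -/
  O : Subring (QuaternionAlgebra ℚ a 0 b)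
  /-- The set of invertible right `O`-ideals. -/
  RI : Set (Submodule ℤ (QuaternionAlgebra ℚ a 0 b))
  /-- The anemic Hecke eigen-predicate on `ℤ/p`-valued functions of right ideals. -/
  IsEig : (Submodule ℤ (QuaternionAlgebra ℚ a 0 b) → ZMod p) → Prop
  /-- The mod-`p` level-raised eigenfunction. -/
  φ : Submodule ℤ (QuaternionAlgebra ℚ a 0 b) → ZMod p
  /-- The embedding `K → B` of the Gross point. -/
  ψ : K →ₐ[ℚ] QuaternionAlgebra ℚ a 0 b
  /-- The right ideal of the Gross point. -/
  I : Submodule ℤ (QuaternionAlgebra ℚ a 0 b)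
  /-- Integral representatives of the ideal classes of `𝓞_K`. -/
  rep : ClassGroup (NumberField.RingOfIntegers K) →
    nonZeroDivisors (Ideal (NumberField.RingOfIntegers K))
  /-- `B` is definite and ramified exactly at the finite prime `q`. -/
  definite : a < 0 ∧ b < 0 ∧ ∀ (ℓ : ℕ) [Fact ℓ.Prime],
    (∀ x : QuaternionAlgebra ℚ_[ℓ] (a : ℚ_[ℓ]) 0 (b : ℚ_[ℓ]), x ≠ 0 → IsUnit x) ↔ ℓ = q
  /-- `O` is an Eichler order of level `N = N_E` (intersection of two maximal orders, index `N`). -/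
  eichler : ∃ O₁ O₂ : Subring (QuaternionAlgebra ℚ a 0 b), (∀ S : Subring (QuaternionAlgebra ℚ a 0 b),
    (S = O₁ ∨ S = O₂) → (S.toAddSubgroup.FG ∧ (∀ d : QuaternionAlgebra ℚ a 0 b, ∃ m : ℤ, m ≠ 0 ∧
      m • d ∈ S) ∧ ∀ S' : Subring (QuaternionAlgebra ℚ a 0 b), S'.toAddSubgroup.FG → S ≤ S' →
      S' = S)) ∧ O = O₁ ⊓ O₂ ∧ O.toAddSubgroup.relIndex O₁.toAddSubgroup = W.conductorNorm ℤ
  /-- `RI` is the set of invertible right `O`-ideals. -/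
  mem_RI : ∀ J : Submodule ℤ (QuaternionAlgebra ℚ a 0 b), J ∈ RI ↔ (J.FG ∧
    (∀ d : QuaternionAlgebra ℚ a 0 b, ∃ m : ℤ, m ≠ 0 ∧ m • d ∈ J) ∧
    (∀ x : QuaternionAlgebra ℚ a 0 b, (∀ y ∈ J, y * x ∈ J) ↔ x ∈ O) ∧
    (∃ J' : Submodule ℤ (QuaternionAlgebra ℚ a 0 b), (∀ x : QuaternionAlgebra ℚ a 0 b,
      x ∈ J * J' ↔ ∀ y ∈ J, x * y ∈ J) ∧ (∀ x : QuaternionAlgebra ℚ a 0 b, x ∈ J' * J ↔ x ∈ O)))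
  /-- The eigen-predicate: `B×`-invariance and `T_ℓ g = a_ℓ(E) g` for `ℓ ∤ N q`. -/
  isEig_iff : ∀ g : Submodule ℤ (QuaternionAlgebra ℚ a 0 b) → ZMod p, IsEig g ↔
    ((∀ J ∈ RI, ∀ β : QuaternionAlgebra ℚ a 0 b, IsUnit β →
      g (J.map (AddMonoidHom.mulLeft β).toIntLinearMap) = g J) ∧
    (∀ ℓ : ℕ, ℓ.Prime → ¬ ℓ ∣ W.conductorNorm ℤ * q → ∀ J ∈ RI,
      ∑ᶠ J' ∈ {J' : Submodule ℤ (QuaternionAlgebra ℚ a 0 b) | J' ≤ J ∧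
        J'.toAddSubgroup.relIndex J.toAddSubgroup = ℓ ^ 2 ∧ ∀ y ∈ J', ∀ x ∈ O, y * x ∈ J'}, g J' =
      ((W.frobeniusTrace ℓ : ℤ) : ZMod p) * g J))
  /-- `φ` is a mod-`p` level-raised eigenfunction … -/
  isEig_φ : IsEig φ
  /-- … primitive … -/
  primitive : ∃ J ∈ RI, IsUnit (φ J)
  /-- … and alone on its eigenline (multiplicity one mod `p` at level `N`, `p² ∣ N`). -/
  multOne : ∀ g : Submodule ℤ (QuaternionAlgebra ℚ a 0 b) → ZMod p, IsEig g →
    ∃ u : ZMod p, ∀ J ∈ RI, g J = u * φ J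
  /-- `(ψ, I)` is a Gross point of conductor `1` (optimal embedding of `𝓞_K` into the left order of
  `I ∈ RI`) and `rep` picks integral representatives of the ideal classes. -/
  grossPoint : I ∈ RI ∧ (∀ x : NumberField.RingOfIntegers K, ∀ y ∈ I, ψ (x : K) * y ∈ I) ∧
    (∀ x : K, (∀ y ∈ I, ψ x * y ∈ I) → ∃ z : NumberField.RingOfIntegers K, (z : K) = x) ∧
    (∀ 𝔞 : ClassGroup (NumberField.RingOfIntegers K), ClassGroup.mk0 (rep 𝔞) = 𝔞)

/-- The TORIC PERIOD `λ(q) = Σ_{[𝔞] ∈ Pic 𝓞_K} φ(ψ(𝔞)·I) ∈ ℤ/p` of the datum (Zhang 2014 §4.1;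
Kim 2024 §4.2.3; Gross 1987 §3). (Verbatim the function of the birth skeleton v2 of crux 20132.)
[cite: WZhang2014, §4.1 (toric period)] [cite: Gross1987, §3] -/
def DefiniteLevelRaisedDatum.toricPeriod {W : WeierstrassCurve ℚ} [W.IsElliptic]
    [W.IsGloballyMinimal] {p : ℕ} {K : Type} [Field K] [NumberField K] {q : ℕ}
    (D : DefiniteLevelRaisedDatum W p K q) : ZMod p :=
  ∑ 𝔞 : ClassGroup (NumberField.RingOfIntegers K), D.φ (Submodule.span ℤ ((fun x :
    NumberField.RingOfIntegers K => D.ψ (x : K)) '' ((D.rep 𝔞 : nonZeroDivisors (Ideal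
    (NumberField.RingOfIntegers K))) : Ideal (NumberField.RingOfIntegers K))) * D.I)

end Summit.BirchSwinnertonDyer.BirchSwinnertonDyer.Theorems.AdditiveKoly

end
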